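import Literature.Algebra.EuclideanLattices.GramSchmidtTableLists
import Literature.Algebra.EuclideanLattices.GramSchmidtTablePrefix
import Mathlib.LinearAlgebra.Matrix.NonsingularInverse
import HarnessLib

/-!
# The exact inverse of a nonsingular integer matrix, read off Cohen's integral Gram–Schmidt table

Topic `Algebra/EuclideanLattices`, sequel of `GramSchmidtTableLists.lean` (Cohen's integer
Gram–Schmidt table as a list program, `tableRec`, `dList`, agreeing with `LLLIntegral.uRec`) and
`GramSchmidtTablePrefix.lean` (on a family with an independent prefix the table entry in the row of an
appended standard basis vector `eₜ` at level/column `k` is the `t`-th coordinate of the INTEGRAL vector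
`dₖ b*ₖ`, `uRec_cast_eq_gramDet_mul_inner`). Written for the bit-level worst-case/average-case
reductions of the lattice trunk (Micciancio–Regev 2007, Thm. 5.9 / Cor. 5.13 / Thm. 5.23 behind
`Literature.Computability.Cryptography.owfExist_of_gapSVP_worstCaseHard`; Regev 2009, Lemma 3.20,
`RegevDualQuery.lean`), all of which compute with the INVERSE of an integer matrix: the dual basis
`(B⁻¹)ᵀ`, reduction modulo a parallelepiped `x − S⌊S⁻¹x⌋`, the query `⌊q S⁻¹ w⌋` of the combining
procedure (MR07 Lemma 5.8). This file supplies that inverse EXACTLY and with integers only, with no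
elimination theory (no Bareiss/Sylvester identity): everything is a by-product of the Gram–Schmidt
table the tree already runs in polynomial time (`Literature.Computability.QuantumComplexity.levelsOf_codeFP`).

## The observation

For linearly independent `t₀, …, t_{n-1} ∈ ℤⁿ` (the rows of `T`), the LAST Gram–Schmidt vector
`t*_{n-1}` is orthogonal to `t₀, …, t_{n-2}` and has `⟪t_{n-1}, t*_{n-1}⟫ = ‖t*_{n-1}‖²`; so
`c = t*_{n-1}/‖t*_{n-1}‖²` solves `T c = e_{n-1}` — it is the last vector of the dual basis (folklore;
e.g. Regev's lecture notes on lattices, Lecture 8, "the dual of the reversed Gram–Schmidt basis").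
With `d_{n-1} t*_{n-1} ∈ ℤⁿ` (LLL82, proof of Prop. 1.26; Cohen §2.6.3) and `dₙ = d_{n-1}‖t*_{n-1}‖²`
this reads `T · (d_{n-1} t*_{n-1}) = dₙ e_{n-1}` in integers, and `dₙ = det(T Tᵀ) = det(T)²` does not
depend on the order of the rows. Moving row `k` to the end and running the same table gives an
integral column `gₖ` with `T gₖ = dₙ eₖ`; hence

  `T · [g₀ | ⋯ | g_{n-1}] = det(T)² · I`,  i.e.  `T⁻¹ = [g₀ | ⋯ | g_{n-1}] / det(T)²`.

## Contents (namespace `GSInverse`; everything PROVED)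

* the list program: `unitRows n` (rows of `Iₙ`), `moveLast rows k` (row `k` moved to the end),
  `invFamily rows k = moveLast rows k ++ unitRows n` (the family handed to Cohen's recursion),
  `invCol rows k` (the column `gₖ`, read off `tableRec (invFamily rows k) n (n-1)` in the rows of the
  unit vectors), `invCols rows`, and `invDen rows = dList rows n n` (`= dₙ`);
* shapes and the reindexing `src` (`(moveLast rows k)[j] = rows[src n k j]`, a bijection of `[0,n)`);
* **`cast_dotZ_invCol`** / **`dotZ_invCol`** — for square `rows` (each of the `n` rows of length `n`)
  with linearly independent real rows: `⟨rows[i], invCol rows k⟩ = if i = k then invDen rows else 0`;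
  `invDen_pos`;
* the matrix form: for `T : Matrix (Fin n) (Fin n) ℤ` with `det T ≠ 0`,
  **`mul_invMatrix`**: `T * invMatrix T = (T.det ^ 2) • 1` with `invMatrix T` the integer matrix of
  columns `gₖ` (`invMatrix_apply`) and **`invDen_eq_det_sq`**: `invDen (rows of T) = det(T)²`.

The typed polynomial-time computation of `(invDen, invCols)` is `IntegerMatrixInverseMachine.lean`.

## References

* H. Cohen, *A Course in Computational Algebraic Number Theory*, GTM 138, Springer 1993, §2.6.3 and
  Algorithm 2.6.7 (integral Gram–Schmidt: `dᵢ`, `d_{i-1} b*ᵢ` integral).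
* A. K. Lenstra, H. W. Lenstra Jr., L. Lovász, *Factoring polynomials with rational coefficients*,
  Math. Ann. 261 (1982), proof of Prop. 1.26 ((1.28)–(1.29): `d_{i-1} b*ᵢ ∈ L`).
* D. Micciancio, O. Regev, *Worst-case to average-case reductions based on Gaussian measures*,
  SIAM J. Comput. 37 (2007), Lemma 5.8 (the combining procedure computes with `S⁻¹`).
-/

noncomputable section

namespace Literature.Algebra.EuclideanLattices

open Finset Module InnerProductSpace
open scoped RealInnerProductSpace

namespace GSInverse

/-! ### The list program -/

/-- The rows of the `n × n` identity matrix, as lists of integers. [folklore] -/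
def unitRows (n : ℕ) : List (List ℤ) :=
  (List.range n).map fun t => (List.range n).map fun s => if s = t then 1 else 0

/-- Row `k` moved to the end: `rows[0..k) ++ rows[k+1..n) ++ [rows[k]]`. [folklore] -/
def moveLast (rows : List (List ℤ)) (k : ℕ) : List (List ℤ) :=
  rows.take k ++ (rows.drop (k + 1) ++ [rows.getD k []])

/-- The family handed to Cohen's recursion for the `k`-th column of the inverse: the rows with row `k`
last, followed by the standard basis vectors `e₀, …, e_{n-1}`. [cite: Cohen1993, Algorithm 2.6.7] -/
def invFamily (rows : List (List ℤ)) (k : ℕ) : List (List ℤ) := moveLast rows k ++ unitRows rows.length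

/-- **The `k`-th column `gₖ = d_{n-1} t*_{n-1}` of `det(T)² · T⁻¹`**, read off Cohen's table of
`invFamily rows k` at level `n - 1`, column `n - 1`, in the rows `n + t` of the unit vectors.
[cite: Cohen1993, §2.6.3] -/
def invCol (rows : List (List ℤ)) (k : ℕ) : List ℤ :=
  (List.range rows.length).map fun t =>
    tabEntry (tableRec (invFamily rows k) rows.length (rows.length - 1)) (rows.length + t) (rows.length - 1)

/-- All the columns `g₀, …, g_{n-1}`. [folklore] -/
def invCols (rows : List (List ℤ)) : List (List ℤ) := (List.range rows.length).map (invCol rows)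

/-- **The common denominator `dₙ = det(T Tᵀ) = det(T)²`** (Cohen's `d` at level `n`). [cite: Cohen1993, §2.6.3] -/
def invDen (rows : List (List ℤ)) : ℤ := dList rows rows.length rows.length

/-! ### Shapes -/

/-- `unitRows n` has `n` rows. [folklore] -/
@[simp] theorem length_unitRows (n : ℕ) : (unitRows n).length = n := by simp [unitRows]

/-- The rows of `unitRows n`. [folklore] -/
theorem getElem_unitRows (n : ℕ) {t : ℕ} (ht : t < (unitRows n).length) :
    (unitRows n)[t] = (List.range n).map fun s => if s = t then (1 : ℤ) else 0 := by
  simp [unitRows]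

/-- Every row of `unitRows n` has length `n`. [folklore] -/
theorem length_of_mem_unitRows {n : ℕ} {r : List ℤ} (h : r ∈ unitRows n) : r.length = n := by
  simp only [unitRows, List.mem_map, List.mem_range] at h
  obtain ⟨t, -, rfl⟩ := h
  simp

/-- The entries of the rows of `unitRows n`: the unit vectors. [folklore] -/
theorem getD_getElem_unitRows (n : ℕ) {t : ℕ} (ht : t < (unitRows n).length) (s : ℕ) :
    ((unitRows n)[t]).getD s 0 = if s = t then (1 : ℤ) else 0 := by
  rw [getElem_unitRows n ht]
  rw [List.getD_eq_getElem?_getD, List.getElem?_map]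
  by_cases hs : s < n
  · rw [List.getElem?_range hs]; simp
  · have ht' : t < n := by simpa using ht
    rw [List.getElem?_eq_none (by simp; omega)]
    simp only [Option.map_none, Option.getD_none]
    rw [if_neg (by omega)]

/-- `moveLast` keeps the number of rows (`k < n`). [folklore] -/
theorem length_moveLast (rows : List (List ℤ)) {k : ℕ} (hk : k < rows.length) :
    (moveLast rows k).length = rows.length := by
  simp only [moveLast, List.length_append, List.length_take, List.length_drop, List.length_singleton]
  omega

/-- The rows of `moveLast rows k` are rows of `rows` (`k < n`). [folklore] -/
theorem mem_of_mem_moveLast (rows : List (List ℤ)) {k : ℕ} (hk : k < rows.length) {r : List ℤ}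
    (h : r ∈ moveLast rows k) : r ∈ rows := by
  simp only [moveLast, List.mem_append, List.mem_singleton] at h
  rcases h with h | h | rfl
  · exact List.mem_of_mem_take h
  · exact List.mem_of_mem_drop h
  · rw [List.getD_eq_getElem _ _ hk]; exact List.getElem_mem hk

/-- `invFamily rows k` has `2n` rows (`k < n`). [folklore] -/
theorem length_invFamily (rows : List (List ℤ)) {k : ℕ} (hk : k < rows.length) :
    (invFamily rows k).length = rows.length + rows.length := by
  rw [invFamily, List.length_append, length_moveLast rows hk, length_unitRows]

/-- `invCol rows k` has `n` entries. [folklore] -/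
@[simp] theorem length_invCol (rows : List (List ℤ)) (k : ℕ) : (invCol rows k).length = rows.length := by
  simp [invCol]

/-- `invCols rows` has `n` columns. [folklore] -/
@[simp] theorem length_invCols (rows : List (List ℤ)) : (invCols rows).length = rows.length := by
  simp [invCols]

/-- The columns of `invCols`. [folklore] -/
theorem getElem_invCols (rows : List (List ℤ)) {k : ℕ} (hk : k < (invCols rows).length) :
    (invCols rows)[k] = invCol rows k := by
  simp [invCols]

/-- The entries of `invCol`. [folklore] -/
theorem getD_invCol (rows : List (List ℤ)) (k : ℕ) {t : ℕ} (ht : t < rows.length) :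
    (invCol rows k).getD t 0 =
      tabEntry (tableRec (invFamily rows k) rows.length (rows.length - 1)) (rows.length + t) (rows.length - 1) := by
  rw [List.getD_eq_getElem _ _ (by simpa using ht)]
  simp [invCol]

/-- `maxWidth` is bounded by a common bound on the row lengths. [folklore] -/
theorem maxWidth_le_of_forall {rows : List (List ℤ)} {D : ℕ} (h : ∀ r ∈ rows, r.length ≤ D) :
    maxWidth rows ≤ D := by
  induction rows with
  | nil => simp [maxWidth]
  | cons r rs ih =>
    have e : maxWidth (r :: rs) = max r.length (maxWidth rs) := rfl
    rw [e]
    exact max_le (h r (by simp)) (ih fun r' hr' => h r' (by simp [hr']))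

/-! ### The reindexing of the rows -/

/-- The source index: `(moveLast rows k)[j] = rows[src n k j]` — `j` below `k`, `j + 1` from `k` up to
`n - 2`, and `k` at the last position `n - 1`. [folklore] -/
def src (n k j : ℕ) : ℕ := if j < k then j else if j + 1 < n then j + 1 else k

/-- `src` stays below `n` (`j, k < n`). [folklore] -/
theorem src_lt {n k j : ℕ} (hk : k < n) (hj : j < n) : src n k j < n := by
  unfold src; split_ifs <;> omega

/-- The last position comes from row `k`. [folklore] -/
theorem src_last {n k : ℕ} (hk : k < n) : src n k (n - 1) = k := by
  unfold src; split_ifs <;> omega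

/-- Only the last position comes from row `k` (`j, k < n`). [folklore] -/
theorem src_eq_iff {n k j : ℕ} (hk : k < n) (hj : j < n) : src n k j = k ↔ j = n - 1 := by
  unfold src; split_ifs <;> omega

/-- `src n k` is injective on `[0, n)`. [folklore] -/
theorem src_injOn {n k j j' : ℕ} (hj : j < n) (hj' : j' < n) (h : src n k j = src n k j') :
    j = j' := by
  unfold src at h; split_ifs at h <;> omega

/-- **The rows of `moveLast`.** [folklore] -/
theorem getElem_moveLast (rows : List (List ℤ)) {k : ℕ} (hk : k < rows.length) {j : ℕ}
    (hj : j < (moveLast rows k).length) :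
    (moveLast rows k)[j] = rows[src rows.length k j]'(src_lt hk (by rwa [length_moveLast rows hk] at hj)) := by
  have hjn : j < rows.length := by rwa [length_moveLast rows hk] at hj
  simp only [moveLast]
  by_cases h1 : j < k
  · rw [List.getElem_append_left (by simp; omega), List.getElem_take]
    simp [src, h1]
  · rw [List.getElem_append_right (by simp; omega)]
    by_cases h2 : j + 1 < rows.length
    · rw [List.getElem_append_left (by simp; omega), List.getElem_drop]
      simp only [List.length_take, src, if_neg h1, if_pos h2]
      congr 1
      omega
    · rw [List.getElem_append_right (by simp; omega)]
      simp only [List.length_take, List.length_drop, List.getElem_singleton, src, if_neg h1, if_neg h2]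
      exact List.getD_eq_getElem _ _ hk

/-- `src` as a permutation of `Fin n`. [folklore] -/
def srcEquiv {n k : ℕ} (hk : k < n) : Fin n ≃ Fin n :=
  Equiv.ofBijective (fun j => ⟨src n k j, src_lt hk j.isLt⟩)
    (Finite.injective_iff_bijective.1 fun j j' h =>
      Fin.ext (src_injOn j.isLt j'.isLt (by simpa using congrArg Fin.val h)))

/-- Values of `srcEquiv`. [folklore] -/
@[simp] theorem srcEquiv_apply {n k : ℕ} (hk : k < n) (j : Fin n) : (srcEquiv hk j : ℕ) = src n k j := rfl

/-- The preimage of `k` is the last position. [folklore] -/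
theorem srcEquiv_symm_apply_eq {n k : ℕ} (hk : k < n) :
    ((srcEquiv hk).symm ⟨k, hk⟩ : ℕ) = n - 1 := by
  have h : srcEquiv hk ⟨n - 1, by omega⟩ = ⟨k, hk⟩ := Fin.ext (by simp [src_last hk])
  rw [← h, Equiv.symm_apply_apply]

/-- The preimages of the other rows are not the last position. [folklore] -/
theorem srcEquiv_symm_apply_lt {n k : ℕ} (hk : k < n) {i : Fin n} (hi : (i : ℕ) ≠ k) :
    ((srcEquiv hk).symm i : ℕ) < n - 1 := by
  set p := (srcEquiv hk).symm i with hp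
  have hpi : srcEquiv hk p = i := by rw [hp, Equiv.apply_symm_apply]
  have hne : (p : ℕ) ≠ n - 1 := by
    intro h
    apply hi
    have := congrArg Fin.val hpi
    simp only [srcEquiv_apply] at this
    rw [← this, h, src_last hk]
  have := p.isLt
  omega

/-! ### The real families -/

variable (rows : List (List ℤ))

/-- The padded rows of a list, as vectors of `ℝᴰ` (the family Cohen's recursion is exact on). [folklore] -/
abbrev realRows (D : ℕ) : Fin rows.length → EuclideanSpace ℝ (Fin D) :=
  ⇑(intVecToEuclidean D).toAddMonoidHom ∘ padFamily rows D

variable {rows}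

/-- The rows of `invFamily` all have length `n` (square `rows`, `k < n`). [folklore] -/
theorem length_of_mem_invFamily (hsq : ∀ r ∈ rows, r.length = rows.length) {k : ℕ} (hk : k < rows.length) {r : List ℤ}
    (h : r ∈ invFamily rows k) : r.length = rows.length := by
  simp only [invFamily, List.mem_append] at h
  rcases h with h | h
  · exact hsq r (mem_of_mem_moveLast rows hk h)
  · exact length_of_mem_unitRows h

/-- `maxWidth (invFamily rows k) ≤ n`. [folklore] -/
theorem maxWidth_invFamily_le (hsq : ∀ r ∈ rows, r.length = rows.length) {k : ℕ} (hk : k < rows.length) :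
    maxWidth (invFamily rows k) ≤ rows.length :=
  maxWidth_le_of_forall fun _ hr => (length_of_mem_invFamily hsq hk hr).le

/-- `maxWidth rows ≤ n` for square `rows`. [folklore] -/
theorem maxWidth_le (hsq : ∀ r ∈ rows, r.length = rows.length) : maxWidth rows ≤ rows.length :=
  maxWidth_le_of_forall fun r hr => (hsq r hr).le

/-- **The first `n` vectors of `invFamily rows k` are the rows, reindexed by `src`.** [folklore] -/
theorem padFamily_invFamily_prefix {k : ℕ} (hk : k < rows.length) (D : ℕ) {j : ℕ} (hj : j < rows.length) :
    padFamily (invFamily rows k) D ⟨j, by rw [length_invFamily rows hk]; omega⟩ =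
      padFamily rows D ⟨src rows.length k j, src_lt hk hj⟩ := by
  funext s
  simp only [padFamily, Fin.getElem_fin]
  have hj' : j < (moveLast rows k).length := by rwa [length_moveLast rows hk]
  have e : (invFamily rows k)[j]'(by rw [length_invFamily rows hk]; omega) = (moveLast rows k)[j] := by
    simp only [invFamily]
    exact List.getElem_append_left hj'
  rw [e, getElem_moveLast rows hk hj']

/-- **The last `n` vectors of `invFamily rows k` are the unit vectors.** [folklore] -/
theorem padFamily_invFamily_unit {k : ℕ} (hk : k < rows.length) {t : ℕ} (ht : t < rows.length) :
    padFamily (invFamily rows k) rows.length ⟨rows.length + t, by rw [length_invFamily rows hk]; omega⟩ =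
      fun s : Fin rows.length => if (s : ℕ) = t then (1 : ℤ) else 0 := by
  funext s
  simp only [padFamily, Fin.getElem_fin]
  have e : (invFamily rows k)[rows.length + t]'(by rw [length_invFamily rows hk]; omega) =
      (unitRows rows.length)[t]'(by simpa using ht) := by
    simp only [invFamily]
    rw [List.getElem_append_right (by rw [length_moveLast rows hk]; omega)]
    simp [length_moveLast rows hk]
  rw [e, getD_getElem_unitRows]

/-- The unit vectors of `ℤⁿ` become `EuclideanSpace.single`. [folklore] -/
theorem intVecToEuclidean_unit (n t : ℕ) (ht : t < n) :
    intVecToEuclidean n (fun s : Fin n => if (s : ℕ) = t then (1 : ℤ) else 0) =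
      EuclideanSpace.single (⟨t, ht⟩ : Fin n) (1 : ℝ) := by
  ext s
  simp only [intVecToEuclidean_apply, PiLp.single_apply]
  by_cases h : s = ⟨t, ht⟩
  · subst h; simp
  · have : (s : ℕ) ≠ t := fun h' => h (Fin.ext h')
    simp [h, this]

/-- **The prefix of the real family of `invFamily rows k` is the real family of the rows composed with
the permutation `srcEquiv`.** [folklore] -/
theorem realRows_invFamily_comp_castLE {k : ℕ} (hk : k < rows.length) (D : ℕ) :
    realRows (invFamily rows k) D ∘ Fin.castLE (show rows.length ≤ (invFamily rows k).length by
        rw [length_invFamily rows hk]; omega) =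
      realRows rows D ∘ srcEquiv hk := by
  funext j
  simp only [Function.comp_apply, realRows]
  congr 1
  exact padFamily_invFamily_prefix hk D j.isLt

/-- Hence that prefix is linearly independent when the rows are. [folklore] -/
theorem linearIndependent_invFamily_prefix {k : ℕ} (hk : k < rows.length) {D : ℕ}
    (hli : LinearIndependent ℝ (realRows rows D)) :
    LinearIndependent ℝ (realRows (invFamily rows k) D ∘ Fin.castLE (show rows.length ≤ (invFamily rows k).length by
        rw [length_invFamily rows hk]; omega)) := by
  rw [realRows_invFamily_comp_castLE hk D]
  exact hli.comp _ (srcEquiv hk).injective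

/-! ### Order-independence of `dₙ` -/

/-- **`dₙ` does not depend on the order of the rows**: the full Gram determinant of the reindexed
prefix of `invFamily rows k` equals that of `rows`. [folklore] -/
theorem gramDet_invFamily_eq {k : ℕ} (hk : k < rows.length) (D : ℕ) :
    gramDet (realRows (invFamily rows k) D) rows.length
        (by rw [length_invFamily rows hk]; omega) =
      gramDet (realRows rows D) rows.length le_rfl := by
  rw [← gramDet_comp_castLE (realRows (invFamily rows k) D) (L := rows.length)
      (by rw [length_invFamily rows hk]; omega) rows.length le_rfl,
    realRows_invFamily_comp_castLE hk D]
  unfold gramDet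
  have e1 : (realRows rows D ∘ ⇑(srcEquiv hk)) ∘ Fin.castLE (le_refl rows.length) =
      (realRows rows D) ∘ ⇑(srcEquiv hk) := by
    funext j; simp
  have e2 : realRows rows D ∘ Fin.castLE (le_refl rows.length) = realRows rows D := by
    funext j; simp
  rw [e1, e2]
  have e3 : Matrix.gram ℝ (realRows rows D ∘ ⇑(srcEquiv hk)) =
      (Matrix.gram ℝ (realRows rows D)).submatrix (srcEquiv hk) (srcEquiv hk) := by
    ext i j; simp [Matrix.gram_apply]
  rw [e3, Matrix.det_submatrix_equiv_self]

/-- `invDen rows` is Cohen's `dₙ` of the real rows (square `rows` with independent rows). [cite: Cohen1993, §2.6.3] -/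
theorem cast_invDen (hsq : ∀ r ∈ rows, r.length = rows.length) (hli : LinearIndependent ℝ (realRows rows rows.length)) :
    (invDen rows : ℝ) = gramDet (realRows rows rows.length) rows.length le_rfl := by
  rw [invDen, dList_eq_dRec rows rows.length (maxWidth_le hsq) (by simp),
    dRec_cast_eq_gramDet_of_prefix (padFamily rows rows.length) le_rfl ?_ rows.length le_rfl]
  have e : padFamily rows rows.length ∘ Fin.castLE (le_refl rows.length) = padFamily rows rows.length := by
    funext j; simp
  rw [show ⇑(intVecToEuclidean rows.length).toAddMonoidHom ∘ padFamily rows rows.length ∘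
      Fin.castLE (le_refl rows.length) = realRows rows rows.length from by rw [e]]
  exact hli

/-- **`invDen rows > 0`** for square `rows` with independent rows. [cite: LenstraLenstraLovasz1982, §1 (the dᵢ are positive integers)] -/
theorem invDen_pos (hsq : ∀ r ∈ rows, r.length = rows.length) (hli : LinearIndependent ℝ (realRows rows rows.length)) :
    0 < invDen rows := by
  have h := one_le_gramDet (padFamily rows rows.length) hli rows.length le_rfl
  rw [← cast_invDen hsq hli] at h
  exact_mod_cast (zero_lt_one.trans_le h)

/-! ### The main identity -/

/-- **The entries of `gₖ` are `d_{n-1} · (t*_{n-1})ₜ`** for the reordered family: for square `rows`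
with independent rows, `k, t < n`, the real value of `(invCol rows k)[t]` is
`d_{n-1}(f) · (b*_{n-1}(f))ₜ` where `f` is the real family of `invFamily rows k`.
[cite: Cohen1993, §2.6.3 (d_{i-1} b*ᵢ is integral)] -/
theorem cast_getD_invCol (hsq : ∀ r ∈ rows, r.length = rows.length) (hli : LinearIndependent ℝ (realRows rows rows.length))
    {k : ℕ} (hk : k < rows.length) {t : ℕ} (ht : t < rows.length) :
    (((invCol rows k).getD t 0 : ℤ) : ℝ) =
      gramDet (realRows (invFamily rows k) rows.length) (rows.length - 1)
          (by rw [length_invFamily rows hk]; omega) *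
        (gramSchmidt ℝ (realRows (invFamily rows k) rows.length)
          ⟨rows.length - 1, by rw [length_invFamily rows hk]; omega⟩) ⟨t, ht⟩ := by
  have hlen : (invFamily rows k).length = rows.length + rows.length := length_invFamily rows hk
  have hD := maxWidth_invFamily_le hsq hk
  rw [getD_invCol rows k ht]
  -- the table entry is `uRec`
  have hmin : min rows.length (invFamily rows k).length = rows.length := by rw [hlen]; simp
  obtain ⟨htab, -⟩ := tabEntry_tableRec_eq_uRec (invFamily rows k) rows.length hD (rows.length - 1)
    (by rw [hmin]; omega)
  have hi : rows.length + t < (invFamily rows k).length := by rw [hlen]; omega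
  have hj : rows.length - 1 < min rows.length (invFamily rows k).length := by rw [hmin]; omega
  rw [htab hi hj]
  -- `uRec = d_{n-1} ⟪e_t, b*_{n-1}⟫`
  have hL : rows.length ≤ (invFamily rows k).length := by rw [hlen]; omega
  have hind := linearIndependent_invFamily_prefix hk (D := rows.length) hli
  have key := uRec_cast_eq_gramDet_mul_inner (padFamily (invFamily rows k) rows.length) hL hind
    (k := rows.length - 1) (by omega) ⟨rows.length + t, hi⟩
  rw [key]
  congr 1
  -- `⟪e_t, b*⟫ = b*_t`
  have eunit : (⇑(intVecToEuclidean rows.length).toAddMonoidHom ∘ padFamily (invFamily rows k) rows.length)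
      ⟨rows.length + t, hi⟩ = EuclideanSpace.single (⟨t, ht⟩ : Fin rows.length) (1 : ℝ) := by
    simp only [Function.comp_apply, LinearMap.toAddMonoidHom_coe]
    rw [padFamily_invFamily_unit hk ht, intVecToEuclidean_unit _ _ ht]
  rw [eunit, EuclideanSpace.inner_single_left, map_one, one_mul]

/-- **Main identity, real form**: for square `rows` with independent rows and `i, k < n`,
`∑ₜ rows[i][t] · (invCol rows k)[t] = [i = k] · invDen rows` — `T gₖ = dₙ eₖ`.
[cite: Cohen1993, §2.6.3; LenstraLenstraLovasz1982, proof of Prop. 1.26] -/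
theorem cast_dotZ_invCol (hsq : ∀ r ∈ rows, r.length = rows.length) (hli : LinearIndependent ℝ (realRows rows rows.length))
    {i k : ℕ} (hi : i < rows.length) (hk : k < rows.length) :
    ((dotZ (rows[i]) (invCol rows k) : ℤ) : ℝ) = if i = k then (invDen rows : ℝ) else 0 := by
  have hn : 0 < rows.length := lt_of_le_of_lt (Nat.zero_le _) hk
  set n := rows.length with hndef
  set fam := invFamily rows k with hfam
  have hlen : fam.length = n + n := length_invFamily rows hk
  have hL : n ≤ fam.length := by rw [hlen]; omega
  set f : Fin fam.length → EuclideanSpace ℝ (Fin n) := realRows fam n with hf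
  set last : Fin fam.length := ⟨n - 1, by rw [hlen]; omega⟩ with hlast
  -- the dot product as a real inner product with `d_{n-1} b*_{n-1}`
  rw [dotZ_eq_sum _ _ (D := n) ((hsq _ (List.getElem_mem hi)).le) (by simp [hndef])]
  push_cast
  have hterm : ∀ t : Fin n, ((rows[i]).getD t 0 : ℝ) * (((invCol rows k).getD t 0 : ℤ) : ℝ) =
      gramDet f (n - 1) (by rw [hlen]; omega) *
        (((rows[i]).getD t 0 : ℝ) * (gramSchmidt ℝ f last) t) := by
    intro t
    rw [cast_getD_invCol hsq hli hk t.isLt]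
    ring
  rw [Finset.sum_congr rfl fun t _ => hterm t, ← Finset.mul_sum]
  -- `∑ₜ rows[i][t] b*_t = ⟪row i, b*⟫`, and `row i = f p` for the source position `p`
  set p : Fin n := (srcEquiv hk).symm ⟨i, hi⟩ with hp
  have hrow : realRows rows n ⟨i, hi⟩ = f (Fin.castLE hL p) := by
    have e := congrFun (realRows_invFamily_comp_castLE hk n) p
    simp only [Function.comp_apply] at e
    rw [hp, Equiv.apply_symm_apply] at e
    rw [hp]
    exact e.symm
  have hinner : ∑ t : Fin n, ((rows[i]).getD t 0 : ℝ) * (gramSchmidt ℝ f last) t =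
      ⟪f (Fin.castLE hL p), gramSchmidt ℝ f last⟫ := by
    rw [← hrow]
    simp only [realRows, Function.comp_apply, LinearMap.toAddMonoidHom_coe, PiLp.inner_apply,
      intVecToEuclidean_apply, RCLike.inner_apply, conj_trivial, padFamily, Fin.getElem_fin]
    refine Finset.sum_congr rfl fun t _ => ?_
    ring
  rw [hinner]
  by_cases hik : i = k
  · -- the last position: `d_{n-1} ⟪t_{n-1}, b*_{n-1}⟫ = d_{n-1} ‖b*_{n-1}‖² = dₙ`
    subst hik
    rw [if_pos rfl]
    have hpv : (p : ℕ) = n - 1 := by rw [hp]; exact srcEquiv_symm_apply_eq hk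
    have hpl : Fin.castLE hL p = last := Fin.ext (by simp [hlast, hpv])
    rw [hpl, inner_self_gramSchmidt, ← gramDet_succ f last]
    rw [gramDet_eq_of_eq f (i' := n) (by simp [hlast]; omega) _ hL, gramDet_invFamily_eq hk n,
      cast_invDen hsq hli]
  · -- another row: orthogonal to the last Gram–Schmidt vector
    rw [if_neg hik]
    have hpv : (p : ℕ) < n - 1 := srcEquiv_symm_apply_lt hk (i := ⟨i, hi⟩) hik
    have hlt : Fin.castLE hL p < last := by
      rw [Fin.lt_def]; simpa [hlast] using hpv
    rw [real_inner_comm, gramSchmidt_inv_triangular ℝ f hlt, mul_zero]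

/-- **Main identity**: `T · [g₀ | ⋯ | g_{n-1}] = dₙ · I` entrywise — for square `rows` with independent
rows and `i, k < n`, `dotZ rows[i] (invCol rows k) = if i = k then invDen rows else 0`.
[cite: Cohen1993, §2.6.3; LenstraLenstraLovasz1982, proof of Prop. 1.26] -/
theorem dotZ_invCol (hsq : ∀ r ∈ rows, r.length = rows.length) (hli : LinearIndependent ℝ (realRows rows rows.length))
    {i k : ℕ} (hi : i < rows.length) (hk : k < rows.length) :
    dotZ (rows[i]) (invCol rows k) = if i = k then invDen rows else 0 := by
  have h := cast_dotZ_invCol hsq hli hi hk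
  split_ifs at h ⊢ <;> exact_mod_cast h

/-! ### Matrix form -/

variable {n : ℕ}

/-- The rows of an integer matrix as lists. [folklore] -/
def rowsOf (T : Matrix (Fin n) (Fin n) ℤ) : List (List ℤ) := List.ofFn fun i => List.ofFn (T i)

/-- `rowsOf T` has `n` rows. [folklore] -/
@[simp] theorem length_rowsOf (T : Matrix (Fin n) (Fin n) ℤ) : (rowsOf T).length = n := by simp [rowsOf]

/-- The rows of `rowsOf T`. [folklore] -/
theorem getElem_rowsOf (T : Matrix (Fin n) (Fin n) ℤ) {i : ℕ} (hi : i < (rowsOf T).length) :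
    (rowsOf T)[i] = List.ofFn (T ⟨i, by simpa using hi⟩) := by
  simp [rowsOf]

/-- `rowsOf T` is square. [folklore] -/
theorem isSquare_rowsOf (T : Matrix (Fin n) (Fin n) ℤ) : ∀ r ∈ rowsOf T, r.length = (rowsOf T).length := by
  intro r hr
  simp only [rowsOf, List.mem_ofFn] at hr
  obtain ⟨i, rfl⟩ := hr
  simp

/-- The padded family of `rowsOf T` is `T` (reindexed along `|rowsOf T| = n`). [folklore] -/
theorem padFamily_rowsOf (T : Matrix (Fin n) (Fin n) ℤ) (i : Fin (rowsOf T).length) :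
    padFamily (rowsOf T) n i = T ⟨i, by simpa using i.isLt⟩ := by
  funext s
  simp only [padFamily, Fin.getElem_fin]
  rw [getElem_rowsOf, List.getD_eq_getElem _ _ (by simp)]
  simp

/-- **The integer matrix `[g₀ | ⋯ | g_{n-1}]` of columns `gₖ`** (`= det(T)² · T⁻¹` for nonsingular `T`).
[cite: Cohen1993, §2.6.3] -/
def invMatrix (T : Matrix (Fin n) (Fin n) ℤ) : Matrix (Fin n) (Fin n) ℤ :=
  Matrix.of fun t k => (invCol (rowsOf T) k).getD t 0

/-- Entries of `invMatrix`. [folklore] -/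
theorem invMatrix_apply (T : Matrix (Fin n) (Fin n) ℤ) (t k : Fin n) :
    invMatrix T t k = (invCol (rowsOf T) k).getD t 0 := rfl

/-- Changing the (propositionally equal) padding width. [folklore] -/
theorem linearIndependent_realRows_congr {rows : List (List ℤ)} {D D' : ℕ} (h : D = D') :
    LinearIndependent ℝ (realRows rows D) ↔ LinearIndependent ℝ (realRows rows D') := by
  subst h; exact Iff.rfl

/-- Changing the (propositionally equal) padding width in a Gram determinant. [folklore] -/
theorem gramDet_realRows_congr (rows : List (List ℤ)) {D D' : ℕ} (h : D = D') (l : ℕ) (hl : l ≤ rows.length) :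
    gramDet (realRows rows D) l hl = gramDet (realRows rows D') l hl := by
  subst h; rfl

/-- Independence of the rows of a nonsingular integer matrix (width `n`). [folklore] -/
theorem linearIndependent_realRows_rowsOf' {T : Matrix (Fin n) (Fin n) ℤ} (hT : T.det ≠ 0) :
    LinearIndependent ℝ (realRows (rowsOf T) n) := by
  -- the real matrix `T` has independent rows
  have hdet : (T.map (Int.cast : ℤ → ℝ)).det ≠ 0 := by
    rw [show T.map (Int.cast : ℤ → ℝ) = (Int.castRingHom ℝ).mapMatrix T from rfl, ← RingHom.map_det,
      eq_intCast]
    exact_mod_cast hT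
  have hrows : LinearIndependent ℝ (T.map (Int.cast : ℤ → ℝ)).row :=
    Matrix.linearIndependent_rows_iff_isUnit.2 ((Matrix.isUnit_iff_isUnit_det _).2 (isUnit_iff_ne_zero.2 hdet))
  -- transport along `WithLp.toLp` and the reindexing `Fin (rowsOf T).length ≃ Fin n`
  have hlin : LinearIndependent ℝ (fun i : Fin n => intVecToEuclidean n (T i)) := by
    have e : (fun i : Fin n => intVecToEuclidean n (T i)) =
        ⇑(WithLp.linearEquiv 2 ℝ (Fin n → ℝ)).symm ∘ (T.map (Int.cast : ℤ → ℝ)).row := by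
      funext i; ext j; simp [Matrix.row]
    rw [e]
    exact hrows.map' _ (LinearEquiv.ker _)
  have e2 : realRows (rowsOf T) n =
      (fun i : Fin n => intVecToEuclidean n (T i)) ∘ (fun i : Fin (rowsOf T).length => (⟨i, by simpa using i.isLt⟩ : Fin n)) := by
    funext i
    simp only [realRows, Function.comp_apply, LinearMap.toAddMonoidHom_coe, padFamily_rowsOf]
  rw [e2]
  exact hlin.comp _ fun i j h => Fin.ext (by simpa using congrArg Fin.val h)

/-- Independence of the rows of a nonsingular integer matrix, in the form Cohen's recursion needs
(width `|rowsOf T|`). [folklore] -/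
theorem linearIndependent_realRows_rowsOf {T : Matrix (Fin n) (Fin n) ℤ} (hT : T.det ≠ 0) :
    LinearIndependent ℝ (realRows (rowsOf T) (rowsOf T).length) :=
  (linearIndependent_realRows_congr (length_rowsOf T)).2 (linearIndependent_realRows_rowsOf' hT)

/-- **`T · invMatrix T = invDen · I`** for a nonsingular integer matrix `T`.
[cite: Cohen1993, §2.6.3; LenstraLenstraLovasz1982, proof of Prop. 1.26] -/
theorem mul_invMatrix_eq_invDen {T : Matrix (Fin n) (Fin n) ℤ} (hT : T.det ≠ 0) :
    T * invMatrix T = (invDen (rowsOf T)) • (1 : Matrix (Fin n) (Fin n) ℤ) := by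
  ext i k
  have hi : (i : ℕ) < (rowsOf T).length := by simp
  have hk : (k : ℕ) < (rowsOf T).length := by simp
  have h := dotZ_invCol (isSquare_rowsOf T) (linearIndependent_realRows_rowsOf hT) hi hk
  rw [dotZ_eq_sum _ _ (D := n) (by simp [getElem_rowsOf]) (by simp)] at h
  rw [Matrix.mul_apply, Matrix.smul_apply, Matrix.one_apply]
  have e : ∑ t, T i t * invMatrix T t k = ∑ t : Fin n, ((rowsOf T)[(i : ℕ)]).getD t 0 * (invCol (rowsOf T) k).getD t 0 := by
    refine Finset.sum_congr rfl fun t _ => ?_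
    rw [invMatrix_apply, getElem_rowsOf, List.getD_eq_getElem _ _ (by simp)]
    simp
  rw [e, h]
  by_cases hik : i = k
  · subst hik; simp
  · have : (i : ℕ) ≠ k := fun h' => hik (Fin.ext h')
    simp [hik, this]

/-- **`invDen (rowsOf T) = det(T)²`**: Cohen's `dₙ` is the Gram determinant `det(T Tᵀ)`.
[cite: Cohen1993, §2.6.3] -/
theorem invDen_eq_det_sq {T : Matrix (Fin n) (Fin n) ℤ} (hT : T.det ≠ 0) :
    invDen (rowsOf T) = T.det ^ 2 := by
  have h := cast_invDen (isSquare_rowsOf T) (linearIndependent_realRows_rowsOf hT)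
  have e2 : realRows (rowsOf T) n =
      fun i : Fin (rowsOf T).length => intVecToEuclidean n (T ⟨i, by simpa using i.isLt⟩) := by
    funext i
    simp only [realRows, Function.comp_apply, LinearMap.toAddMonoidHom_coe, padFamily_rowsOf]
  rw [gramDet_realRows_congr (rowsOf T) (length_rowsOf T)] at h
  unfold gramDet at h
  rw [show realRows (rowsOf T) n ∘ Fin.castLE (le_refl (rowsOf T).length) = realRows (rowsOf T) n from by
    funext j; simp, e2, gram_intVecToEuclidean] at h
  -- reindex `Fin (rowsOf T).length ≃ Fin n` and identify the Gram matrix with `T Tᵀ`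
  have hlen : (rowsOf T).length = n := length_rowsOf T
  have hgram : (Matrix.of fun i j : Fin (rowsOf T).length =>
      ∑ t, T ⟨i, by simpa using i.isLt⟩ t * T ⟨j, by simpa using j.isLt⟩ t) =
      (T * T.transpose).submatrix (fun i : Fin (rowsOf T).length => (⟨i, by simpa using i.isLt⟩ : Fin n))
        (fun j : Fin (rowsOf T).length => (⟨j, by simpa using j.isLt⟩ : Fin n)) := by
    ext i j
    simp [Matrix.mul_apply, Matrix.transpose_apply]
  have hdet : (Matrix.of fun i j : Fin (rowsOf T).length =>
      ∑ t, T ⟨i, by simpa using i.isLt⟩ t * T ⟨j, by simpa using j.isLt⟩ t).det = T.det ^ 2 := by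
    rw [hgram]
    have : (fun i : Fin (rowsOf T).length => (⟨i, by simpa using i.isLt⟩ : Fin n)) = ⇑(finCongr hlen) := by
      funext i; ext; simp
    rw [this, Matrix.det_submatrix_equiv_self, Matrix.det_mul, Matrix.det_transpose, sq]
  have h' : ((invDen (rowsOf T) : ℤ) : ℝ) = ((T.det ^ 2 : ℤ) : ℝ) := by
    rw [h, ← hdet, Int.cast_det]
  exact_mod_cast h'

/-- **`T · invMatrix T = det(T)² · I`**: the exact inverse of a nonsingular integer matrix, with integers
only — `T⁻¹ = invMatrix T / det(T)²`. [cite: Cohen1993, §2.6.3; LenstraLenstraLovasz1982, proof of Prop. 1.26] -/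
theorem mul_invMatrix {T : Matrix (Fin n) (Fin n) ℤ} (hT : T.det ≠ 0) :
    T * invMatrix T = (T.det ^ 2) • (1 : Matrix (Fin n) (Fin n) ℤ) := by
  rw [mul_invMatrix_eq_invDen hT, invDen_eq_det_sq hT]

/-- The real inverse: `T⁻¹ = (det T)⁻² · invMatrix T` over `ℝ`. [folklore] -/
theorem inv_eq_smul_invMatrix {T : Matrix (Fin n) (Fin n) ℤ} (hT : T.det ≠ 0) :
    (T.map (Int.cast : ℤ → ℝ))⁻¹ = ((T.det : ℝ) ^ 2)⁻¹ • (invMatrix T).map (Int.cast : ℤ → ℝ) := by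
  have hdet : (T.map (Int.cast : ℤ → ℝ)).det ≠ 0 := by
    rw [show T.map (Int.cast : ℤ → ℝ) = (Int.castRingHom ℝ).mapMatrix T from rfl, ← RingHom.map_det,
      eq_intCast]
    exact_mod_cast hT
  have hmul : T.map (Int.cast : ℤ → ℝ) * (invMatrix T).map (Int.cast : ℤ → ℝ) =
      ((T.det : ℝ) ^ 2) • (1 : Matrix (Fin n) (Fin n) ℝ) := by
    have e1 : T.map (Int.cast : ℤ → ℝ) * (invMatrix T).map (Int.cast : ℤ → ℝ) =
        (T * invMatrix T).map (Int.cast : ℤ → ℝ) :=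
      (Matrix.map_mul (f := Int.castRingHom ℝ)).symm
    rw [e1, mul_invMatrix hT]
    ext i j
    rw [Matrix.map_apply, Matrix.smul_apply, Matrix.smul_apply, Matrix.one_apply, Matrix.one_apply]
    split_ifs <;> simp
  have hd2 : ((T.det : ℝ) ^ 2) ≠ 0 := pow_ne_zero 2 (by exact_mod_cast hT)
  have hinv : T.map (Int.cast : ℤ → ℝ) * (((T.det : ℝ) ^ 2)⁻¹ • (invMatrix T).map (Int.cast : ℤ → ℝ)) = 1 := by
    rw [Matrix.mul_smul, hmul, smul_smul, inv_mul_cancel₀ hd2, one_smul]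
  exact Matrix.inv_eq_right_inv hinv

end GSInverse

end Literature.Algebra.EuclideanLattices

end
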